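import Literature.NumberTheory.Rogawski1990.KottwitzSign
import HarnessLib

/-!
# The Kottwitz sign of a split-singular class by a UNIPOTENT CRITERION: `e(γ) = −1` iff the centraliser of `γ` in
# `U(H)(K)` has no unipotent element `≠ 1` (Rogawski 1990, §4.1 (4.1.2), §8.2; Kottwitz 1983)

Topic `NumberTheory/Rogawski1990`; namespace `Literature.NumberTheory.Rogawski1990`. THEOREMS ONLY over accepted tree modules
and ★ `KottwitzSign`: no definition, no named fact, no instance, no notation, no `sorry`. Cell `pub/hodgecm-mathlib`, ENGINE T1
(crux H413 = `stmt-HodgeConjecture-24833`), O7 row (ψ-e) of A-p01's OWNER WORD #26 (2), road (d1′) «UNIPOTENT CRITERION».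

THE POINT. ★ `kottwitzSign σ H X` is DEFINED through isotropic eigenvectors (`−1` iff some split-singular datum `(a, b)` of `X`
has NO non-zero `H`-isotropic eigenvector: the eigenplane `W_a` is anisotropic, `G_X = U(W_a) × U(1)` has rank `0`,
[Rogawski1990, §8.2 p. 117 «`e(γ₀) = 1, e(γ₀′) = −1`»]). This file proves that for `X ∈ U(H)(K)` over a FIELD `K` with a
non-trivial involution `σ` and a non-degenerate hermitian `H ∈ M₃(K)` the sign is INTRINSIC to the abstract group
`U(H)(K)` with its conjugation on matrices:

  `e(X) = −1 ↔ (X is split-singular) ∧ (every unipotent u ∈ U(H)(K) commuting with X is 1)`,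

so it is preserved by every matrix conjugation `g ↦ S⁻¹ g S` carrying `U(H)(K)` onto `U(H′)(K)` — the shape of the engine's local
identifications `ψ_v : U(H)(L⁺_v) ≅ U(Φ₃)(L⁺_v)` (★ `UnitaryGroup.exists_psi_conj_forall_levelMatching`, family pin (vii-c)).

* §1 (private plumbing) the Gram form `h(u, v) = hermForm σ H u v`: conjugate symmetry, `h(0, v) = 0`, the outer-product matrix
  `vecMulVec e ((σ ∘ e) ᵥ* H)` («`x ↦ h(e, x) · e`»), and «a matrix is `0` iff it kills every vector».
* §2 **`hasIsotropicEigenvector_of_unipotent_commute`** — FRAME-FREE «⇒»: if `u ∈ U(H)` is unipotent (`(u − 1)³ = 0`),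
  `u ≠ 1`, and commutes with a split-singular `X` (`(X − a)(X − b) = 0`, `a − b` a unit), then `X` has a non-zero ISOTROPIC
  eigenvector: with `N := u − 1` and the spectral projector `π_a := (a − b)⁻¹ (X − b)` (`X π_a = a π_a`, `π_a + π_b = 1`),
  `N = N π_a + N π_b`, so some `N π ≠ 0`; for `k ∈ {1, 2}` maximal with `N^k π ≠ 0`, `v := N^k π x₀ ≠ 0` is an eigenvector with
  `N v = 0` and `v = N w`, `w := N^{k−1} π x₀`; and unitarity `h(Np, q) + h(p, Nq) + h(Np, Nq) = 0` at `(p, q) := (v, w)` reads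
  `h(v, v) = 0`.
* §3 **`exists_unipotent_commute_of_isotropic_eigenvector`** — «⇐» by the EICHLER TRANSVECTION: from an isotropic eigenvector
  `e` of `X ∈ U(H)` (`X e = λ e`, `σ(λ) λ = 1`, `h(e, e) = 0`), `t ≠ 0` with `σ t = −t` and `det H ≠ 0`, the matrix
  `u := 1 + t · e · ᵗ(σe) H` (`x ↦ x + t h(e, x) e`) lies in `U(H)`, commutes with `X`, `(u − 1)² = 0`, `u ≠ 1`.
* §4 **`kottwitzSign_eq_neg_one_iff_forall_unipotent_eq_one`** — the criterion for `γ ∈ U(H)(K)`, `H ∈ M₃(K)` hermitian with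
  `det H ≠ 0`, `σ` an involution `≠ id` (the eigenvalues of a unitary split-singular `γ` have `σ(λ)λ = 1` by ★
  `exists_singular_frame`), and **`kottwitzSign_conj_eq_of_forall_mem_iff`** — invariance under every conjugation
  `g ↦ S⁻¹ g S` with `U(H) ↦ U(H′)`.

## References
* [Rogawski1990] J. D. Rogawski, *Automorphic Representations of Unitary Groups in Three Variables*, Ann. of Math. Stud. 123 (1990),
  §4.1 (4.1.2) pp. 39–40; §3.8 Prop. 3.8.1 (a) p. 30; §8.2 p. 117.
* [Kottwitz1983] R. E. Kottwitz, *Sign changes in harmonic analysis on reductive groups*, Trans. AMS 278 (1983), 289–297.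
-/

set_option autoImplicit false

noncomputable section

open Matrix
open scoped MatrixGroups

namespace Literature.NumberTheory.Rogawski1990

open Literature.AlgebraicGeometry.ShimuraVarieties (unitaryGroup mem_unitaryGroup_iff hermForm)

/-! ## §1 Plumbing: the Gram form, outer products, matrices killing every vector -/

section Plumbing

variable {K : Type*} [CommRing K] {n : Type*} [Fintype n] [DecidableEq n] (σ : K →+* K) (H : Matrix n n K)

omit [DecidableEq n] in
/-- `h(0, v) = 0`. [folklore] -/
private theorem hermForm_zero_left (v : n → K) : hermForm σ H 0 v = 0 := by
  have h := hermForm_smul_left σ H (0 : K) (0 : n → K) v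
  rw [zero_smul, map_zero, zero_mul] at h
  exact h

omit [DecidableEq n] in
/-- `h(u, 0) = 0`. [folklore] -/
private theorem hermForm_zero_right (u : n → K) : hermForm σ H u 0 = 0 := by
  have h := hermForm_smul_right σ H (0 : K) u (0 : n → K)
  rw [zero_smul, zero_mul] at h
  exact h

omit [DecidableEq n] in
/-- Conjugate symmetry `σ h(x, y) = h(y, x)` for `σ` an involution and `H` `σ`-hermitian. [folklore] -/
private theorem map_hermForm_eq (hσ : ∀ x, σ (σ x) = x) (hH : (H.map σ)ᵀ = H) (x y : n → K) :
    σ (hermForm σ H x y) = hermForm σ H y x := by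
  have hHij : ∀ i j, σ (H i j) = H j i := fun i j => by
    have := congrFun (congrFun hH j) i
    rw [Matrix.transpose_apply, Matrix.map_apply] at this
    exact this
  simp only [hermForm, dotProduct, mulVec, Function.comp_apply, map_sum, map_mul, hσ, Finset.mul_sum]
  rw [Finset.sum_comm]
  refine Finset.sum_congr rfl fun i _ => Finset.sum_congr rfl fun j _ => ?_
  rw [hHij]
  ring

omit [DecidableEq n] in
/-- `h(x, M y) = ((σ ∘ x) ᵥ* H) ⬝ᵥ (M y)` bookkeeping: `h(e, x) = ((σ ∘ e) ᵥ* H) ⬝ᵥ x`. [folklore] -/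
private theorem hermForm_eq_vecMul_dotProduct (e x : n → K) : hermForm σ H e x = ((σ ∘ e) ᵥ* H) ⬝ᵥ x := by
  rw [hermForm, dotProduct_mulVec]

omit [DecidableEq n] in
/-- The outer-product matrix `E := e ⊗ ᵗ(σe)H` acts by `E x = h(e, x) • e`. [folklore] -/
private theorem vecMulVec_conj_mulVec (e x : n → K) :
    vecMulVec e ((σ ∘ e) ᵥ* H) *ᵥ x = hermForm σ H e x • e := by
  ext i
  rw [hermForm_eq_vecMul_dotProduct]
  simp only [Matrix.mulVec, dotProduct, Matrix.vecMulVec_apply, Pi.smul_apply, smul_eq_mul, Finset.sum_mul]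
  exact Finset.sum_congr rfl fun j _ => by ring

/-- A square matrix over a commutative ring that kills every vector is `0`. [folklore] -/
private theorem eq_zero_of_forall_mulVec_eq_zero {M : Matrix n n K} (h : ∀ x : n → K, M *ᵥ x = 0) : M = 0 := by
  ext i j
  have := congrFun (h (Pi.single j 1)) i
  rw [Matrix.mulVec_single_one] at this
  simpa using this

/-- Two square matrices with the same action on every vector are equal. [folklore] -/
private theorem eq_of_forall_mulVec_eq {M M' : Matrix n n K} (h : ∀ x : n → K, M *ᵥ x = M' *ᵥ x) : M = M' := by
  rw [← sub_eq_zero]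
  exact eq_zero_of_forall_mulVec_eq_zero fun x => by rw [Matrix.sub_mulVec, h x, sub_self]

/-- A non-zero square matrix moves some vector. [folklore] -/
private theorem exists_mulVec_ne_zero {M : Matrix n n K} (hM : M ≠ 0) : ∃ x : n → K, M *ᵥ x ≠ 0 := by
  by_contra h
  push Not at h
  exact hM (eq_zero_of_forall_mulVec_eq_zero h)

/-- UNITARITY POLARISED: for `u ∈ U(H)` and `N := u − 1`, `h(Np, q) + h(p, Nq) + h(Np, Nq) = 0`. [folklore] -/
private theorem hermForm_unitary_polar {u : Matrix n n K} (hu : (u.map σ)ᵀ * H * u = H) (p q : n → K) :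
    hermForm σ H ((u - 1) *ᵥ p) q + hermForm σ H p ((u - 1) *ᵥ q) + hermForm σ H ((u - 1) *ᵥ p) ((u - 1) *ᵥ q) = 0 := by
  have hcongr : hermForm σ H (u *ᵥ p) (u *ᵥ q) = hermForm σ H p q := by rw [← hermForm_congr, hu]
  have hp : u *ᵥ p = p + (u - 1) *ᵥ p := by rw [Matrix.sub_mulVec, Matrix.one_mulVec, add_sub_cancel]
  have hq : u *ᵥ q = q + (u - 1) *ᵥ q := by rw [Matrix.sub_mulVec, Matrix.one_mulVec, add_sub_cancel]
  rw [hp, hq, hermForm_add_left, hermForm_add_right, hermForm_add_right] at hcongr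
  linear_combination hcongr

end Plumbing

/-! ## §2 «⇒»: a non-trivial unipotent in the centraliser produces an isotropic eigenvector (frame-free) -/

section Forward

variable {K : Type*} [Field K] {n : Type*} [Fintype n] [DecidableEq n] {σ : K →+* K} {H : Matrix n n K}

/-- The core step: for `u ∈ U(H)`, `N := u − 1`, vectors with `N w = v` and `N v = 0` give `h(v, v) = 0`. [folklore] -/
private theorem hermForm_self_eq_zero_of_step {u : Matrix n n K} (hu : (u.map σ)ᵀ * H * u = H) {v w : n → K}
    (hw : (u - 1) *ᵥ w = v) (hv : (u - 1) *ᵥ v = 0) : hermForm σ H v v = 0 := by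
  have h := hermForm_unitary_polar σ H hu v w
  rw [hv, hw, hermForm_zero_left, hermForm_zero_left, zero_add, add_zero] at h
  exact h

/-- The two spectral idempotents of a split-singular `X`: `X · ((a − b)⁻¹ (X − b)) = a · ((a − b)⁻¹ (X − b))`, so the image of
`π_a := (a − b)⁻¹ (X − b)` consists of `a`-eigenvectors. [cite: Rogawski1990, §3.8 p. 30] -/
private theorem mul_proj_eq_smul {X : Matrix n n K} {a b : K}
    (hX : (X - a • (1 : Matrix n n K)) * (X - b • (1 : Matrix n n K)) = 0) :
    X * ((a - b)⁻¹ • (X - b • (1 : Matrix n n K))) = a • ((a - b)⁻¹ • (X - b • (1 : Matrix n n K))) := by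
  have h1 : (X - a • (1 : Matrix n n K)) * (X - b • (1 : Matrix n n K)) =
      X * (X - b • (1 : Matrix n n K)) - a • (X - b • (1 : Matrix n n K)) := by
    rw [Matrix.sub_mul, Matrix.smul_mul, Matrix.one_mul]
  rw [h1, sub_eq_zero] at hX
  rw [Matrix.mul_smul, hX, smul_comm]

/-- The split-singular relation is symmetric in `(a, b)`: `(X − b)(X − a) = (X − a)(X − b)`. [folklore] -/
private theorem sub_smul_mul_comm (X : Matrix n n K) (a b : K) :
    (X - b • (1 : Matrix n n K)) * (X - a • (1 : Matrix n n K)) = (X - a • (1 : Matrix n n K)) * (X - b • (1 : Matrix n n K)) := by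
  simp only [Matrix.sub_mul, Matrix.mul_sub, Matrix.smul_mul, Matrix.mul_smul, Matrix.one_mul, Matrix.mul_one]
  module

omit [Fintype n] in
/-- `π_a + π_b = 1`. [folklore] -/
private theorem proj_add_proj {X : Matrix n n K} {a b : K} (hab : a - b ≠ 0) :
    (a - b)⁻¹ • (X - b • (1 : Matrix n n K)) + (b - a)⁻¹ • (X - a • (1 : Matrix n n K)) = 1 := by
  have hba : (b - a)⁻¹ = -(a - b)⁻¹ := by rw [← neg_sub, neg_inv]
  rw [hba, neg_smul, ← sub_eq_add_neg, ← smul_sub, sub_sub_sub_cancel_left, ← sub_smul, smul_smul,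
    inv_mul_cancel₀ hab, one_smul]

/-- One branch of «⇒»: if `N π ≠ 0` for `N := u − 1` (`u ∈ U(H)` unipotent commuting with `X`) and a spectral idempotent `π`
(`X π = c π`), then `X` has a non-zero isotropic `c`-eigenvector. [cite: Rogawski1990, §8.2 p. 117] -/
private theorem exists_isotropic_eigenvector_of_ne_zero {u X P N : Matrix n n K} {c : K} (hu : (u.map σ)ᵀ * H * u = H)
    (hNu : u - 1 = N) (hXN : X * N = N * X) (hXP : X * P = c • P) (hN3 : N ^ 3 = 0) (hne : N * P ≠ 0) :
    ∃ v : n → K, v ≠ 0 ∧ X *ᵥ v = c • v ∧ hermForm σ H v v = 0 := by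
  -- eigenvector bookkeeping: `X (N^k P x) = c • N^k P x`
  have heig : ∀ (k : ℕ) (x : n → K), X *ᵥ ((N ^ k * P) *ᵥ x) = c • ((N ^ k * P) *ᵥ x) := by
    intro k x
    have hcomm : X * N ^ k = N ^ k * X := by
      induction k with
      | zero => rw [pow_zero, Matrix.mul_one, Matrix.one_mul]
      | succ k ih => rw [pow_succ, ← Matrix.mul_assoc, ih, Matrix.mul_assoc, hXN, ← Matrix.mul_assoc]
    rw [Matrix.mulVec_mulVec, ← Matrix.mul_assoc, hcomm, Matrix.mul_assoc, hXP, Matrix.mul_smul, Matrix.smul_mulVec]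
  by_cases h2 : N * N * P = 0
  · -- `k = 1`: `v := N P x₀`, `w := P x₀`
    obtain ⟨x₀, hx₀⟩ := exists_mulVec_ne_zero (M := N * P) hne
    refine ⟨(N * P) *ᵥ x₀, hx₀, ?_, ?_⟩
    · have := heig 1 x₀
      rwa [pow_one] at this
    · refine hermForm_self_eq_zero_of_step (σ := σ) (H := H) hu (w := P *ᵥ x₀) ?_ ?_
      · rw [hNu, Matrix.mulVec_mulVec]
      · rw [hNu, Matrix.mulVec_mulVec, ← Matrix.mul_assoc, h2, Matrix.zero_mulVec]
  · -- `k = 2`: `v := N² P x₀`, `w := N P x₀`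
    obtain ⟨x₀, hx₀⟩ := exists_mulVec_ne_zero (M := N * N * P) h2
    refine ⟨(N * N * P) *ᵥ x₀, hx₀, ?_, ?_⟩
    · have := heig 2 x₀
      rwa [pow_two] at this
    · refine hermForm_self_eq_zero_of_step (σ := σ) (H := H) hu (w := (N * P) *ᵥ x₀) ?_ ?_
      · rw [hNu, Matrix.mulVec_mulVec, ← Matrix.mul_assoc]
      · have h3 : N * (N * N * P) = 0 := by
          have : N * (N * N * P) = N ^ 3 * P := by rw [pow_succ, pow_two]; simp only [Matrix.mul_assoc]
          rw [this, hN3, Matrix.zero_mul]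
        rw [hNu, Matrix.mulVec_mulVec, h3, Matrix.zero_mulVec]

/-- **«⇒» (frame-free): a unipotent `u ≠ 1` of `U(H)` commuting with a split-singular `X` forces an isotropic eigenvector.**
For `u ∈ U(H)(K)` with `(u − 1)³ = 0`, `u ≠ 1`, `u X = X u`, and `(X − a)(X − b) = 0` with `a − b` a unit: `X` has a non-zero
`H`-isotropic eigenvector for `a` or for `b` (`HasIsotropicEigenvector σ H X a b`). So at a class WITHOUT isotropic eigenvector
(`e(X) = −1`: anisotropic eigenplane, `G_X = U(W_a) × U(1)` of rank `0`) the centraliser has no unipotent `≠ 1`.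
[cite: Rogawski1990, §8.2 p. 117] [cite: Kottwitz1983, §1] -/
theorem hasIsotropicEigenvector_of_unipotent_commute {u X : Matrix n n K} {a b : K} (hu : (u.map σ)ᵀ * H * u = H)
    (hc : u * X = X * u) (hN3 : (u - 1) ^ 3 = 0) (hu1 : u ≠ 1) (hab : IsUnit (a - b))
    (hX : (X - a • (1 : Matrix n n K)) * (X - b • (1 : Matrix n n K)) = 0) :
    HasIsotropicEigenvector σ H X a b := by
  have hab0 : a - b ≠ 0 := hab.ne_zero
  -- `N := u − 1`, opaque
  obtain ⟨N, hNu⟩ : ∃ N : Matrix n n K, u - 1 = N := ⟨_, rfl⟩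
  rw [hNu] at hN3
  have hXN : X * N = N * X := by rw [← hNu, Matrix.mul_sub, Matrix.sub_mul, Matrix.mul_one, Matrix.one_mul, hc]
  -- `N` commutes with polynomials in `X`
  have hNX' : ∀ c : K, N * (X - c • (1 : Matrix n n K)) = (X - c • (1 : Matrix n n K)) * N := by
    intro c
    rw [Matrix.mul_sub, Matrix.sub_mul, hXN, Matrix.mul_smul, Matrix.mul_one, Matrix.smul_mul, Matrix.one_mul]
  -- the eigen-relations of the two projectors
  have hXPa : X * ((a - b)⁻¹ • (X - b • (1 : Matrix n n K))) = a • ((a - b)⁻¹ • (X - b • (1 : Matrix n n K))) :=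
    mul_proj_eq_smul hX
  have hXPb : X * ((b - a)⁻¹ • (X - a • (1 : Matrix n n K))) = b • ((b - a)⁻¹ • (X - a • (1 : Matrix n n K))) :=
    mul_proj_eq_smul (by rw [sub_smul_mul_comm]; exact hX)
  -- `N = N π_a + N π_b`, so one of them is non-zero
  have hsum : N * ((a - b)⁻¹ • (X - b • (1 : Matrix n n K))) + N * ((b - a)⁻¹ • (X - a • (1 : Matrix n n K))) = N := by
    rw [← Matrix.mul_add, proj_add_proj hab0, Matrix.mul_one]
  have hN0 : N ≠ 0 := fun h => hu1 (sub_eq_zero.1 (hNu.trans h))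
  by_cases ha : N * ((a - b)⁻¹ • (X - b • (1 : Matrix n n K))) = 0
  · have hb : N * ((b - a)⁻¹ • (X - a • (1 : Matrix n n K))) ≠ 0 := by
      intro hb; apply hN0; rw [← hsum, ha, hb, add_zero]
    obtain ⟨v, hv0, hv, hiso⟩ := exists_isotropic_eigenvector_of_ne_zero (σ := σ) (H := H) hu hNu hXN hXPb hN3 hb
    exact ⟨v, hv0, Or.inr hv, hiso⟩
  · obtain ⟨v, hv0, hv, hiso⟩ := exists_isotropic_eigenvector_of_ne_zero (σ := σ) (H := H) hu hNu hXN hXPa hN3 ha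
    exact ⟨v, hv0, Or.inl hv, hiso⟩

end Forward

/-! ## §3 «⇐»: the Eichler transvection along an isotropic eigenvector -/

section Backward

variable {K : Type*} [Field K] {n : Type*} [Fintype n] [DecidableEq n] {σ : K →+* K} {H : Matrix n n K}

/-- **THE EICHLER TRANSVECTION** `u := 1 + t · e ⊗ ᵗ(σe)H` (`x ↦ x + t h(e, x) e`) along a non-zero ISOTROPIC eigenvector `e`
of `X ∈ U(H)` (`X e = λ e`, `σ(λ) λ = 1`, `h(e, e) = 0`), with `t ≠ 0`, `σ t = −t` and `det H ≠ 0`: `u ∈ U(H)`, `u X = X u`,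
`(u − 1)² = 0` and `u ≠ 1` — a non-trivial unipotent in the centraliser (the isotropic eigenplane carries `U(1,1)`, «`e(γ₀) = 1`»).
[cite: Rogawski1990, §8.2 p. 117] [cite: Kottwitz1983, §1] -/
theorem exists_unipotent_commute_of_isotropic_eigenvector (hσ : ∀ x, σ (σ x) = x) (hH : (H.map σ)ᵀ = H) (hdet : H.det ≠ 0)
    {X : Matrix n n K} (hX : (X.map σ)ᵀ * H * X = H) {e : n → K} (he : e ≠ 0) {μ : K} (heig : X *ᵥ e = μ • e)
    (hμ : σ μ * μ = 1) (hiso : hermForm σ H e e = 0) {t : K} (ht : σ t = -t) (ht0 : t ≠ 0) :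
    ∃ u : GL n K, u ∈ unitaryGroup σ H ∧ (u : Matrix n n K) * X = X * (u : Matrix n n K) ∧
      ((u : Matrix n n K) - 1) ^ 2 = 0 ∧ (u : Matrix n n K) ≠ 1 := by
  obtain ⟨N, hN⟩ : ∃ N : Matrix n n K, N = t • Matrix.vecMulVec e ((σ ∘ e) ᵥ* H) := ⟨_, rfl⟩
  -- the action of `N`
  have hNx : ∀ x : n → K, N *ᵥ x = (t * hermForm σ H e x) • e := by
    intro x
    rw [hN, Matrix.smul_mulVec, vecMulVec_conj_mulVec, smul_smul]
  -- `N² = 0`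
  have hN2 : N * N = 0 := eq_zero_of_forall_mulVec_eq_zero fun x => by
    rw [← Matrix.mulVec_mulVec, hNx x, Matrix.mulVec_smul, hNx e, hiso, mul_zero, zero_smul, smul_zero]
  -- the unit `u = 1 + N`, inverse `1 − N`
  have hinv1 : (1 + N) * (1 - N) = 1 := by
    rw [Matrix.add_mul, Matrix.mul_sub, Matrix.mul_sub, Matrix.one_mul, Matrix.one_mul, Matrix.mul_one, hN2, sub_zero,
      sub_add_cancel]
  have hinv2 : (1 - N) * (1 + N) = 1 := by
    rw [Matrix.sub_mul, Matrix.mul_add, Matrix.mul_add, Matrix.one_mul, Matrix.one_mul, Matrix.mul_one, hN2, add_zero,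
      add_sub_cancel_right]
  let u : GL n K := ⟨1 + N, 1 - N, hinv1, hinv2⟩
  have hu : (u : Matrix n n K) = 1 + N := rfl
  -- `h(e, X x) = μ h(e, x)` (unitarity of `X` and `σ(μ) μ = 1`)
  have heX : ∀ x : n → K, hermForm σ H e (X *ᵥ x) = μ * hermForm σ H e x := by
    intro x
    have h1 : hermForm σ H (X *ᵥ e) (X *ᵥ x) = hermForm σ H e x := by rw [← hermForm_congr, hX]
    rw [heig, hermForm_smul_left] at h1
    have hμ0 : σ μ ≠ 0 := fun h0 => by rw [h0, zero_mul] at hμ; exact zero_ne_one hμ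
    have hμinv : μ = (σ μ)⁻¹ := (eq_inv_of_mul_eq_one_right hμ)
    rw [hμinv, ← h1, ← mul_assoc, inv_mul_cancel₀ hμ0, one_mul]
  refine ⟨u, ?_, ?_, ?_, ?_⟩
  · -- unitarity: `h(u p, u q) = h(p, q)`, read on the standard basis
    rw [Literature.AlgebraicGeometry.ShimuraVarieties.mem_unitaryGroup_iff, hu]
    have hpol : ∀ p q : n → K, hermForm σ H ((1 + N) *ᵥ p) ((1 + N) *ᵥ q) = hermForm σ H p q := by
      intro p q
      rw [Matrix.add_mulVec, Matrix.add_mulVec, Matrix.one_mulVec, Matrix.one_mulVec, hNx, hNx,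
        hermForm_add_left, hermForm_add_right, hermForm_add_right, hermForm_smul_left, hermForm_smul_right,
        hermForm_smul_left, hermForm_smul_right, hiso, map_mul, ht, map_hermForm_eq σ H hσ hH e p]
      ring
    ext i j
    rw [← hermForm_single_single σ (((1 + N).map σ)ᵀ * H * (1 + N)) i j, hermForm_congr, hpol, hermForm_single_single]
  · -- commutes with `X`
    rw [hu, Matrix.add_mul, Matrix.mul_add, Matrix.one_mul, Matrix.mul_one]
    congr 1
    exact eq_of_forall_mulVec_eq fun x => by
      rw [← Matrix.mulVec_mulVec, ← Matrix.mulVec_mulVec, hNx, hNx, Matrix.mulVec_smul, heig, heX, smul_smul]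
      ring_nf
  · -- `(u − 1)² = N² = 0`
    rw [hu, add_sub_cancel_left, pow_two, hN2]
  · -- `u ≠ 1`: some `f` has `h(e, f) ≠ 0` by non-degeneracy, and `N f = t h(e,f) e ≠ 0`
    intro h1
    have hN0 : N = 0 := by
      have h2 : (u : Matrix n n K) - 1 = 0 := by rw [h1, sub_self]
      rwa [hu, add_sub_cancel_left] at h2
    -- `(σ ∘ e) ᵥ* H ≠ 0`
    have hrow : (σ ∘ e) ᵥ* H ≠ 0 := by
      intro h0
      have hinj : Function.Injective H.vecMul :=
        Matrix.vecMul_injective_iff_isUnit.2 ((Matrix.isUnit_iff_isUnit_det H).2 (isUnit_iff_ne_zero.2 hdet))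
      have hσe : σ ∘ e = 0 := hinj (by show (σ ∘ e) ᵥ* H = 0 ᵥ* H; rw [h0, Matrix.zero_vecMul])
      apply he
      funext i
      have := congrFun hσe i
      simp only [Function.comp_apply, Pi.zero_apply] at this
      rw [← hσ (e i), this, map_zero, Pi.zero_apply]
    obtain ⟨j, hj⟩ : ∃ j, ((σ ∘ e) ᵥ* H) j ≠ 0 := by
      by_contra hall
      push Not at hall
      exact hrow (funext hall)
    have hf : hermForm σ H e (Pi.single j 1) ≠ 0 := by
      rw [hermForm_eq_vecMul_dotProduct, dotProduct_single_one]
      exact hj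
    obtain ⟨i, hi⟩ : ∃ i, e i ≠ 0 := by
      by_contra hall; push Not at hall; exact he (funext hall)
    have := congrFun (hNx (Pi.single j 1)) i
    rw [hN0, Matrix.zero_mulVec, Pi.zero_apply, Pi.smul_apply, smul_eq_mul] at this
    exact mul_ne_zero (mul_ne_zero ht0 hf) hi this.symm

end Backward

/-! ## §4 The criterion and its conjugation invariance (`n = 3`) -/

section Criterion

variable {K : Type*} [Field K] {σ : K →+* K}

/-- Both eigenvalues of a unitary split-singular `γ ∈ U(H)(K)` (`H ∈ M₃(K)` hermitian, `det H ≠ 0`) have `σ(λ) λ = 1`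
(★ `exists_singular_frame`). [cite: Rogawski1990, §3.8 Prop. 3.8.1 p. 27] -/
theorem conj_mul_self_eq_one_of_isSplitSingular (hσ : ∀ x, σ (σ x) = x) {H : Matrix (Fin 3) (Fin 3) K} (hH : (H.map σ)ᵀ = H)
    (hdet : H.det ≠ 0) (γ : unitaryGroup σ H) {a b : K}
    (hs : IsSplitSingular (((γ : GL (Fin 3) K)) : Matrix (Fin 3) (Fin 3) K) a b) : σ a * a = 1 ∧ σ b * b = 1 := by
  obtain ⟨hab, hprod, hα, hβ⟩ := hs
  have hab' : a ≠ b := fun h => hab.ne_zero (sub_eq_zero.2 h)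
  obtain ⟨a', b', -, -, -, hperm, haa, hbb, -⟩ := exists_singular_frame σ hσ H hH hdet γ hab' hprod hα hβ
  rcases hperm with ⟨rfl, rfl⟩ | ⟨rfl, rfl⟩
  · exact ⟨haa, hbb⟩
  · exact ⟨hbb, haa⟩

/-- **THE UNIPOTENT CRITERION FOR THE KOTTWITZ SIGN** (`K` a field, `σ` an involution of `K` with `σ ≠ id`, `H ∈ M₃(K)` hermitian with
`det H ≠ 0`, `γ ∈ U(H)(K)`): `e(γ) = −1` iff `γ` is split-singular for some `(a, b)` AND every unipotent element of `U(H)(K)` commuting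
with `γ` is trivial — i.e. the centraliser `G_γ(K) = U(W_a) × U(1)` contains no unipotent `≠ 1` (the eigenplane `W_a` is anisotropic,
`q(G_γ) = 0`), versus the isotropic case `G_γ ≅ U(1,1) × U(1)` where the Eichler transvections live («`e(γ₀) = 1, e(γ₀′) = −1`»).
The right-hand side is INTRINSIC to the group `U(H)(K)` and matrix conjugation. [cite: Rogawski1990, §4.1 (4.1.2) pp. 39–40; §8.2 p. 117]
[cite: Kottwitz1983, §1] -/
theorem kottwitzSign_eq_neg_one_iff_forall_unipotent_eq_one (hσ : ∀ x, σ (σ x) = x) (hσ1 : ∃ x, σ x ≠ x)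
    {H : Matrix (Fin 3) (Fin 3) K} (hH : (H.map σ)ᵀ = H) (hdet : H.det ≠ 0) (γ : unitaryGroup σ H) :
    kottwitzSign σ H (((γ : GL (Fin 3) K)) : Matrix (Fin 3) (Fin 3) K) = -1 ↔
      (∃ a b : K, IsSplitSingular (((γ : GL (Fin 3) K)) : Matrix (Fin 3) (Fin 3) K) a b) ∧
      ∀ u : GL (Fin 3) K, u ∈ unitaryGroup σ H →
        (u : Matrix (Fin 3) (Fin 3) K) * ((γ : GL (Fin 3) K) : Matrix (Fin 3) (Fin 3) K) =
          ((γ : GL (Fin 3) K) : Matrix (Fin 3) (Fin 3) K) * (u : Matrix (Fin 3) (Fin 3) K) →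
        ((u : Matrix (Fin 3) (Fin 3) K) - 1) ^ 3 = 0 → (u : Matrix (Fin 3) (Fin 3) K) = 1 := by
  have hXU : ((((γ : GL (Fin 3) K)) : Matrix (Fin 3) (Fin 3) K).map σ)ᵀ * H * ((γ : GL (Fin 3) K) : Matrix (Fin 3) (Fin 3) K) = H :=
    Literature.AlgebraicGeometry.ShimuraVarieties.mem_unitaryGroup_iff.1 γ.2
  constructor
  · intro h
    obtain ⟨a, b, hs, hn⟩ := (kottwitzSign_eq_neg_one_iff _).1 h
    refine ⟨⟨a, b, hs⟩, fun u hu hc hN3 => ?_⟩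
    by_contra hu1
    exact hn (hasIsotropicEigenvector_of_unipotent_commute
      (Literature.AlgebraicGeometry.ShimuraVarieties.mem_unitaryGroup_iff.1 hu) hc hN3 hu1 hs.1 hs.2.1)
  · rintro ⟨⟨a, b, hs⟩, hno⟩
    refine kottwitzSign_eq_neg_one_of_not_hasIsotropicEigenvector hs fun hiso => ?_
    obtain ⟨e, he0, heig, he⟩ := hiso
    obtain ⟨haa, hbb⟩ := conj_mul_self_eq_one_of_isSplitSingular hσ hH hdet γ hs
    -- `t ≠ 0` with `σ t = −t`
    obtain ⟨x, hx⟩ := hσ1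
    have ht : σ (x - σ x) = -(x - σ x) := by rw [map_sub, hσ, neg_sub]
    have ht0 : x - σ x ≠ 0 := fun h0 => hx (sub_eq_zero.1 h0).symm
    -- an eigenvalue `μ ∈ {a, b}` with `X e = μ e`
    obtain ⟨μ, hμe, hμ⟩ : ∃ μ : K, ((γ : GL (Fin 3) K) : Matrix (Fin 3) (Fin 3) K) *ᵥ e = μ • e ∧ σ μ * μ = 1 := by
      rcases heig with h | h
      · exact ⟨a, h, haa⟩
      · exact ⟨b, h, hbb⟩
    obtain ⟨u, huU, huc, hu2, hu1⟩ :=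
      exists_unipotent_commute_of_isotropic_eigenvector hσ hH hdet hXU he0 hμe hμ he ht ht0
    refine hu1 (hno u huU huc ?_)
    rw [pow_succ, hu2, Matrix.zero_mul]

/-- **CONJUGATION INVARIANCE OF THE SIGN** (`K`, `σ`, `H`, `H′` as above): if `S ∈ GL₃(K)` conjugates `U(H)(K)` onto `U(H′)(K)`
(`g ∈ U(H) ↔ S⁻¹ g S ∈ U(H′)` — e.g. a form congruence or a similitude, the shape of the engine's `ψ_v`), then
`e_{H′}(S⁻¹ γ S) = e_H(γ)` for every `γ ∈ U(H)(K)`: by the unipotent criterion both signs are read off the same abstract group.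
[cite: Rogawski1990, §4.1 (4.1.2) pp. 39–40] [cite: Kottwitz1983, §1] -/
theorem kottwitzSign_conj_eq_of_forall_mem_iff (hσ : ∀ x, σ (σ x) = x) (hσ1 : ∃ x, σ x ≠ x)
    {H H' : Matrix (Fin 3) (Fin 3) K} (hH : (H.map σ)ᵀ = H) (hdet : H.det ≠ 0) (hH' : (H'.map σ)ᵀ = H') (hdet' : H'.det ≠ 0)
    (S : GL (Fin 3) K) (hS : ∀ g : GL (Fin 3) K, g ∈ unitaryGroup σ H ↔ S⁻¹ * g * S ∈ unitaryGroup σ H')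
    (γ : unitaryGroup σ H) :
    kottwitzSign σ H' (((S⁻¹ : GL (Fin 3) K) : Matrix (Fin 3) (Fin 3) K) * ((γ : GL (Fin 3) K) : Matrix (Fin 3) (Fin 3) K) *
        (S : Matrix (Fin 3) (Fin 3) K)) =
      kottwitzSign σ H (((γ : GL (Fin 3) K)) : Matrix (Fin 3) (Fin 3) K) := by
  obtain ⟨X, hXdef⟩ : ∃ X : Matrix (Fin 3) (Fin 3) K, ((γ : GL (Fin 3) K) : Matrix (Fin 3) (Fin 3) K) = X := ⟨_, rfl⟩
  rw [hXdef]
  let γ' : unitaryGroup σ H' := ⟨S⁻¹ * (γ : GL (Fin 3) K) * S, (hS _).1 γ.2⟩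
  have hγ' : (((γ' : GL (Fin 3) K)) : Matrix (Fin 3) (Fin 3) K) =
      ((S⁻¹ : GL (Fin 3) K) : Matrix (Fin 3) (Fin 3) K) * X * (S : Matrix (Fin 3) (Fin 3) K) := by
    simp only [γ', Units.val_mul, hXdef]
  have hSi : ((S⁻¹ : GL (Fin 3) K) : Matrix (Fin 3) (Fin 3) K) * (S : Matrix (Fin 3) (Fin 3) K) = 1 := by
    rw [← Units.val_mul, inv_mul_cancel, Units.val_one]
  have hiS : (S : Matrix (Fin 3) (Fin 3) K) * ((S⁻¹ : GL (Fin 3) K) : Matrix (Fin 3) (Fin 3) K) = 1 := by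
    rw [← Units.val_mul, mul_inv_cancel, Units.val_one]
  -- the two criteria agree
  have hsplit : (∃ a b : K, IsSplitSingular (((γ' : GL (Fin 3) K)) : Matrix (Fin 3) (Fin 3) K) a b) ↔
      ∃ a b : K, IsSplitSingular X a b := by
    rw [hγ']
    refine exists_congr fun a => exists_congr fun b => ?_
    have := isSplitSingular_units_conj_iff (S⁻¹) X a b
    rwa [inv_inv] at this
  -- conjugation bookkeeping
  have hST' : ∀ Y : Matrix (Fin 3) (Fin 3) K, (S : Matrix (Fin 3) (Fin 3) K) * (((S⁻¹ : GL (Fin 3) K) : Matrix (Fin 3) (Fin 3) K) * Y) = Y := fun Y => by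
    rw [← Matrix.mul_assoc, hiS, Matrix.one_mul]
  have hTS' : ∀ Y : Matrix (Fin 3) (Fin 3) K, ((S⁻¹ : GL (Fin 3) K) : Matrix (Fin 3) (Fin 3) K) * ((S : Matrix (Fin 3) (Fin 3) K) * Y) = Y := fun Y => by
    rw [← Matrix.mul_assoc, hSi, Matrix.one_mul]
  have hpow_to : ∀ (A : Matrix (Fin 3) (Fin 3) K) (k : ℕ),
      (((S⁻¹ : GL (Fin 3) K) : Matrix (Fin 3) (Fin 3) K) * A * (S : Matrix (Fin 3) (Fin 3) K)) ^ k = ((S⁻¹ : GL (Fin 3) K) : Matrix (Fin 3) (Fin 3) K) * A ^ k * (S : Matrix (Fin 3) (Fin 3) K) := by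
    intro A k
    induction k with
    | zero => rw [pow_zero, pow_zero, Matrix.mul_one, hSi]
    | succ k ih =>
      rw [pow_succ, ih, pow_succ]
      simp only [Matrix.mul_assoc, hST']
  have hpow_from : ∀ (A : Matrix (Fin 3) (Fin 3) K) (k : ℕ),
      ((S : Matrix (Fin 3) (Fin 3) K) * A * ((S⁻¹ : GL (Fin 3) K) : Matrix (Fin 3) (Fin 3) K)) ^ k = (S : Matrix (Fin 3) (Fin 3) K) * A ^ k * ((S⁻¹ : GL (Fin 3) K) : Matrix (Fin 3) (Fin 3) K) := by
    intro A k
    induction k with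
    | zero => rw [pow_zero, pow_zero, Matrix.mul_one, hiS]
    | succ k ih =>
      rw [pow_succ, ih, pow_succ]
      simp only [Matrix.mul_assoc, hTS']
  have hunip : (∀ u : GL (Fin 3) K, u ∈ unitaryGroup σ H' →
        (u : Matrix (Fin 3) (Fin 3) K) * (((γ' : GL (Fin 3) K)) : Matrix (Fin 3) (Fin 3) K) =
          (((γ' : GL (Fin 3) K)) : Matrix (Fin 3) (Fin 3) K) * (u : Matrix (Fin 3) (Fin 3) K) →
        ((u : Matrix (Fin 3) (Fin 3) K) - 1) ^ 3 = 0 → (u : Matrix (Fin 3) (Fin 3) K) = 1) ↔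
      ∀ u : GL (Fin 3) K, u ∈ unitaryGroup σ H →
        (u : Matrix (Fin 3) (Fin 3) K) * X = X * (u : Matrix (Fin 3) (Fin 3) K) →
        ((u : Matrix (Fin 3) (Fin 3) K) - 1) ^ 3 = 0 → (u : Matrix (Fin 3) (Fin 3) K) = 1 := by
    rw [hγ']
    constructor
    · intro h u hu hc hN3
      -- transport `u ↦ S⁻¹ u S`
      have hu' : S⁻¹ * u * S ∈ unitaryGroup σ H' := (hS u).1 hu
      have hcoe : ((S⁻¹ * u * S : GL (Fin 3) K) : Matrix (Fin 3) (Fin 3) K) = ((S⁻¹ : GL (Fin 3) K) : Matrix (Fin 3) (Fin 3) K) * (u : Matrix (Fin 3) (Fin 3) K) * (S : Matrix (Fin 3) (Fin 3) K) := by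
        simp only [Units.val_mul]
      have hc' : ((S⁻¹ * u * S : GL (Fin 3) K) : Matrix (Fin 3) (Fin 3) K) * (((S⁻¹ : GL (Fin 3) K) : Matrix (Fin 3) (Fin 3) K) * X * (S : Matrix (Fin 3) (Fin 3) K)) =
          ((S⁻¹ : GL (Fin 3) K) : Matrix (Fin 3) (Fin 3) K) * X * (S : Matrix (Fin 3) (Fin 3) K) * ((S⁻¹ * u * S : GL (Fin 3) K) : Matrix (Fin 3) (Fin 3) K) := by
        rw [hcoe]
        simp only [Matrix.mul_assoc, hST']
        rw [← Matrix.mul_assoc (u : Matrix (Fin 3) (Fin 3) K) X, hc, Matrix.mul_assoc]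
      have hN3' : (((S⁻¹ * u * S : GL (Fin 3) K) : Matrix (Fin 3) (Fin 3) K) - 1) ^ 3 = 0 := by
        rw [hcoe, show ((S⁻¹ : GL (Fin 3) K) : Matrix (Fin 3) (Fin 3) K) * (u : Matrix (Fin 3) (Fin 3) K) * (S : Matrix (Fin 3) (Fin 3) K) - 1 =
          ((S⁻¹ : GL (Fin 3) K) : Matrix (Fin 3) (Fin 3) K) * ((u : Matrix (Fin 3) (Fin 3) K) - 1) * (S : Matrix (Fin 3) (Fin 3) K) by
            rw [Matrix.mul_sub, Matrix.sub_mul, Matrix.mul_one, hSi], hpow_to, hN3, Matrix.mul_zero, Matrix.zero_mul]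
      have h1 := h (S⁻¹ * u * S) hu' hc' hN3'
      rw [hcoe] at h1
      -- `S⁻¹ u S = 1 ⇒ u = 1`
      have h2 : (S : Matrix (Fin 3) (Fin 3) K) * (((S⁻¹ : GL (Fin 3) K) : Matrix (Fin 3) (Fin 3) K) * (u : Matrix (Fin 3) (Fin 3) K) * (S : Matrix (Fin 3) (Fin 3) K)) * ((S⁻¹ : GL (Fin 3) K) : Matrix (Fin 3) (Fin 3) K) =
          (u : Matrix (Fin 3) (Fin 3) K) := by
        simp only [Matrix.mul_assoc, hST', hiS, Matrix.mul_one]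
      rw [← h2, h1, Matrix.mul_one, hiS]
    · intro h u' hu' hc' hN3'
      -- transport back `u' ↦ S u' S⁻¹`
      have hu : S * u' * S⁻¹ ∈ unitaryGroup σ H := by
        rw [hS]
        have : S⁻¹ * (S * u' * S⁻¹) * S = u' := by group
        rw [this]; exact hu'
      have hcoe : ((S * u' * S⁻¹ : GL (Fin 3) K) : Matrix (Fin 3) (Fin 3) K) = (S : Matrix (Fin 3) (Fin 3) K) * (u' : Matrix (Fin 3) (Fin 3) K) * ((S⁻¹ : GL (Fin 3) K) : Matrix (Fin 3) (Fin 3) K) := by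
        simp only [Units.val_mul]
      have hc : ((S * u' * S⁻¹ : GL (Fin 3) K) : Matrix (Fin 3) (Fin 3) K) * X = X * ((S * u' * S⁻¹ : GL (Fin 3) K) : Matrix (Fin 3) (Fin 3) K) := by
        rw [hcoe]
        have h2 : (S : Matrix (Fin 3) (Fin 3) K) * ((u' : Matrix (Fin 3) (Fin 3) K) * (((S⁻¹ : GL (Fin 3) K) : Matrix (Fin 3) (Fin 3) K) * X * (S : Matrix (Fin 3) (Fin 3) K))) * ((S⁻¹ : GL (Fin 3) K) : Matrix (Fin 3) (Fin 3) K) =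
            (S : Matrix (Fin 3) (Fin 3) K) * ((((S⁻¹ : GL (Fin 3) K) : Matrix (Fin 3) (Fin 3) K) * X * (S : Matrix (Fin 3) (Fin 3) K)) * (u' : Matrix (Fin 3) (Fin 3) K)) * ((S⁻¹ : GL (Fin 3) K) : Matrix (Fin 3) (Fin 3) K) := by
          rw [hc']
        simp only [Matrix.mul_assoc, hST', hiS, Matrix.mul_one] at h2
        simp only [Matrix.mul_assoc]
        exact h2
      have hN3 : (((S * u' * S⁻¹ : GL (Fin 3) K) : Matrix (Fin 3) (Fin 3) K) - 1) ^ 3 = 0 := by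
        rw [hcoe, show (S : Matrix (Fin 3) (Fin 3) K) * (u' : Matrix (Fin 3) (Fin 3) K) * ((S⁻¹ : GL (Fin 3) K) : Matrix (Fin 3) (Fin 3) K) - 1 =
          (S : Matrix (Fin 3) (Fin 3) K) * ((u' : Matrix (Fin 3) (Fin 3) K) - 1) * ((S⁻¹ : GL (Fin 3) K) : Matrix (Fin 3) (Fin 3) K) by
            rw [Matrix.mul_sub, Matrix.sub_mul, Matrix.mul_one, hiS], hpow_from, hN3', Matrix.mul_zero, Matrix.zero_mul]
      have h1 := h (S * u' * S⁻¹) hu hc hN3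
      rw [hcoe] at h1
      have h2 : ((S⁻¹ : GL (Fin 3) K) : Matrix (Fin 3) (Fin 3) K) * ((S : Matrix (Fin 3) (Fin 3) K) * (u' : Matrix (Fin 3) (Fin 3) K) * ((S⁻¹ : GL (Fin 3) K) : Matrix (Fin 3) (Fin 3) K)) * (S : Matrix (Fin 3) (Fin 3) K) =
          (u' : Matrix (Fin 3) (Fin 3) K) := by
        simp only [Matrix.mul_assoc, hTS', hSi, Matrix.mul_one]
      rw [← h2, h1, Matrix.mul_one, hSi]
  -- both signs are `±1` and are `−1` simultaneously
  have key : kottwitzSign σ H' (((γ' : GL (Fin 3) K)) : Matrix (Fin 3) (Fin 3) K) = -1 ↔ kottwitzSign σ H X = -1 := by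
    have h2 := kottwitzSign_eq_neg_one_iff_forall_unipotent_eq_one hσ hσ1 hH hdet γ
    rw [hXdef] at h2
    rw [kottwitzSign_eq_neg_one_iff_forall_unipotent_eq_one hσ hσ1 hH' hdet' γ', h2, hsplit, hunip]
  rw [← hγ']
  rcases kottwitzSign_eq_one_or_eq_neg_one (σ := σ) (H := H) X with h | h
  · rw [h]
    rcases kottwitzSign_eq_one_or_eq_neg_one (σ := σ) (H := H') (((γ' : GL (Fin 3) K)) : Matrix (Fin 3) (Fin 3) K) with h' | h'
    · exact h'
    · exact absurd (key.1 h') (by rw [h]; decide)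
  · rw [h]
    exact key.2 h

end Criterion

end Literature.NumberTheory.Rogawski1990
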